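import Mathlib
import Summits.ValiantsHypothesis.ValiantsHypothesis.Theses.GrenetZeon
import Summits.ValiantsHypothesis.ValiantsHypothesis.Theorems.GrenetZeonTwoDimCoefficientsDefs
import Summits.ValiantsHypothesis.ValiantsHypothesis.Theorems.GrenetZeonTwoDimCoefficientsDualUnipotentTriangular

/-!
# LINE «wild_mass» — PARAMETER MASS OF THE WILD CONSTITUENTS ⇒ the 3/2 rung
(val-idea-9 g0, lens NEGATION: portrait of a minimal counterexample to `DualUnipotentThreeHalves`, second half)

Target decl BY NAME: `Summit.ValiantsHypothesis.ValiantsHypothesis.Theses.GrenetZeon.DualUnipotentThreeHalves`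
(stmt-ValiantsHypothesis-24318; bears on stmt-ValiantsHypothesis-8062 `TwoDimCoefficients ↔ DualUnipotentBound`).

HONEST FRAMING.  Ideator skeleton: F1 is PROVED here (`levelFlat_proof`: the landed triangularisable-rung ARGUMENT,
p593700 = block grading + LEMMA_k `finrank_le_of_iterD_perPoly_eq_zero`, re-run for an ARBITRARY level function); the ONE
open stub is F2, the per-specific crux; the composition is kernel-checked.  Nothing here proves the rung for wild pencils;
`VP ≠ VNP` is not moved.

THE PORTRAIT (this line's half).  Normal form `per_n = tr(N^{n−1}M)` (p589181), pencil space `𝓛 = {N(x)}` of dimension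
`≥ n² − 2n` (LEMMA_1).  Along any `𝓛`-invariant chain with `g` levels, the directions `v` along which the DIAGONAL
constituents do not move form a subspace `K`; on every coset of `K` the pencil is block-GRADED for the levels, so
`tr(N^{n−1}M)` has degree `≤ g` there and LEMMA_g gives `dim K ≤ 2gn` (F1, PROVED below).  Hence
`n² ≤ 2gn + codim K = 2gn + (parameter mass of the diagonal constituents)`.  Coarsening the finest chain (irreducible
constituents of dimensions `D_l`; Mathes–Omladič–Radjavi 1991 §5: these can be as fat as `(d/3)²+1`) into `2k` groups:
`n² ≤ 4kn + m²/k + Σ_l D_l + 2n` for every `k`, so a counterexample with `m = n^{3/2}/ω` must have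
`Σ_l D_l ≥ (1 − O(1/ω))·n²`: THE WILD (irreducible, nil-index ≥ 3 by Radjavi–Rosenthal Thm 9.1.2) CONSTITUENTS CARRY
ALMOST ALL `n²` PARAMETERS, and (Gerstenhaber `D_l ≤ d_l²/2`) those of size `≥ ε·n²/m` carry `≥ (1−ε)·n²` of them.
Stub F2 (crux) says per_n never needs that: some representation of the same width has a chain with `g = O(m/√n + 1)`
levels whose diagonal constituents carry only `O(m·√n)` parameters.  F2 holds for every triangularisable representation
(levels = `⌈√n⌉`-blocks of the flag: `g ≤ m/√n + 1`, mass `≤ m√n/2`), in particular for the profile-barrier chain: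
it GENERALISES the landed rung exactly to «wild but parameter-light».

Companion line «wild_unfold» (same seat): the index-mass half.  The two are independent sufficient conditions; a minimal
counterexample violates BOTH: fat, parameter-heavy irreducible constituents AND large index mass.
-/

set_option linter.dupNamespace false
set_option autoImplicit false

noncomputable section

namespace Summit.ValiantsHypothesis.ValiantsHypothesis.Cruxes.DualUnipotentThreeHalves.WildMass

open MvPolynomial Matrix
open scoped BigOperators
open Literature.Computability.AlgebraicComplexity
open Summit.ValiantsHypothesis.ValiantsHypothesis.Cruxes.TwoDimCoefficients.DimTwoCases
  (AffMat IsAffine DualUnipotentRepr foldr_mkDerivation_eq_zero_of_totalDegree_le totalDegree_aeval_line_le_one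
    aeval_line_of_totalDegree_le_one finrank_le_of_iterD_perPoly_eq_zero)
open Summit.ValiantsHypothesis.ValiantsHypothesis.Theses.GrenetZeon (DualUnipotentThreeHalves)

/-! ## Block data -/

/-- `N` is block-upper-triangular for the level function `lev` (entry `i → j` vanishes unless `lev i ≤ lev j`). -/
def IsBlockUpper {n m : ℕ} (N : AffMat n m) (lev : Fin m → ℕ) : Prop :=
  ∀ i j : Fin m, lev j < lev i → N i j = 0

/-- The linear coefficient of entry `(i, j)` of the pencil in direction `v`: `Σ_c v_c · [x_c](N i j)`. -/
def linCoeff {n m : ℕ} (N : AffMat n m) (v : Fin n × Fin n → ℂ) (i j : Fin m) : ℂ :=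
  ∑ c, v c * coeff (Finsupp.single c 1) (N i j)

/-- `K` is a space of directions along which the DIAGONAL constituents of the block form do not move. -/
def DiagStill {n m : ℕ} (N : AffMat n m) (lev : Fin m → ℕ) (K : Submodule ℂ (Fin n × Fin n → ℂ)) : Prop :=
  ∀ v ∈ K, ∀ i j : Fin m, lev i = lev j → linCoeff N v i j = 0

/-! ## The two statements (F1 proved below, F2 = the open stub) -/

/-- **F1 — LEVEL FLATNESS (PROVED: `levelFlat_proof`; p593700's proof with an arbitrary level function).**  If `per_n = tr(N^d·M)`
with `N, M` affine, `N` block-upper for a level function with `< g` levels, and the diagonal constituents are still along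
`K`, then along every coset of `K` the pencil is block-graded, `tr(N^d M)` has degree `≤ g`, all `(g+1)`-st derivatives
of `per_n` along `K` vanish, and LEMMA_g (`finrank_le_of_iterD_perPoly_eq_zero`) gives `dim K ≤ 2gn`. -/
def LevelFlat : Prop :=
  ∀ (n m d g : ℕ) (N M : AffMat n m) (lev : Fin m → ℕ) (K : Submodule ℂ (Fin n × Fin n → ℂ)),
    IsAffine N → IsAffine M → IsBlockUpper N lev → (∀ u : Fin m, lev u < g) →
      perPoly (Fin n) ℂ = (N ^ d * M).trace → DiagStill N lev K → Module.finrank ℂ K ≤ 2 * g * n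

/-- **F2 — CHEAP PARAMETER MASS (the crux of the line; per-specific; the typed obstruction).**  Every unipotent dual
representation of `per_n` of width `m` can be replaced by one of the same width with a block form of `O(m/√n + 1)` levels
whose diagonal constituents move only in codimension `O(m·√n)`.  Negation = the portrait: in every block form of every
width-`m` representation of a counterexample family, the diagonal (wild) constituents carry `(1 − o(1))·n²` parameters. -/
def CheapParameterMass : Prop :=
  ∃ C n₀ : ℕ, ∀ n ≥ n₀, ∀ m : ℕ, DualUnipotentRepr n m →
    ∃ (N M : AffMat n m) (lev : Fin m → ℕ) (g : ℕ) (K : Submodule ℂ (Fin n × Fin n → ℂ)),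
      IsAffine N ∧ IsAffine M ∧ perPoly (Fin n) ℂ = (N ^ (n - 1) * M).trace ∧ IsBlockUpper N lev ∧
        (∀ u : Fin m, lev u < g) ∧ DiagStill N lev K ∧
        g * Nat.sqrt n ≤ C * (m + Nat.sqrt n) ∧ n ^ 2 ≤ Module.finrank ℂ K + C * m * Nat.sqrt n

theorem stub_cheapParameterMass : CheapParameterMass := by
  sorry

/-! ## F1 PROVED — block grading for an arbitrary level function (p593700's argument verbatim with `lev`) -/
section LevelFlatProof

variable {m k : ℕ}

/-- Products of level-graded matrices (degree + lev(row) ≤ lev(col) on non-zero entries) are level-graded. [folklore] -/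
theorem levGraded_mul (lev : Fin m → ℕ) (Y Z : Matrix (Fin m) (Fin m) (MvPolynomial (Fin (k + 1)) ℂ))
    (hY : ∀ i j, Y i j ≠ 0 → (Y i j).totalDegree + lev i ≤ lev j)
    (hZ : ∀ i j, Z i j ≠ 0 → (Z i j).totalDegree + lev i ≤ lev j) :
    ∀ i j, (Y * Z) i j ≠ 0 → ((Y * Z) i j).totalDegree + lev i ≤ lev j := by
  intro i j hij
  rw [Matrix.mul_apply] at hij ⊢
  obtain ⟨l, -, hl⟩ := Finset.exists_ne_zero_of_sum_ne_zero hij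
  have hYl : Y i l ≠ 0 := fun h => hl (by rw [h, zero_mul])
  have hZl : Z l j ≠ 0 := fun h => hl (by rw [h, mul_zero])
  have hblock : lev i ≤ lev j :=
    ((Nat.le_add_left _ _).trans (hY i l hYl)).trans ((Nat.le_add_left _ _).trans (hZ l j hZl))
  have hterm : ∀ l', (Y i l' * Z l' j).totalDegree + lev i ≤ lev j := by
    intro l'
    by_cases h0 : Y i l' * Z l' j = 0
    · rw [h0, totalDegree_zero, zero_add]; exact hblock
    · have h1 := hY i l' (fun h => h0 (by rw [h, zero_mul]))
      have h2 := hZ l' j (fun h => h0 (by rw [h, mul_zero]))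
      have h3 := totalDegree_mul (Y i l') (Z l' j)
      omega
  have hsum := totalDegree_finsetSum Finset.univ (fun l' => Y i l' * Z l' j)
  have hsup : (Finset.univ.sup fun l' => (Y i l' * Z l' j).totalDegree) + lev i ≤ lev j := by
    have : Finset.univ.sup (fun l' => (Y i l' * Z l' j).totalDegree) ≤ lev j - lev i :=
      Finset.sup_le fun l' _ => by have := hterm l'; omega
    omega
  omega

/-- Powers of a level-graded matrix are level-graded. [folklore] -/
theorem levGraded_pow (lev : Fin m → ℕ) (Y : Matrix (Fin m) (Fin m) (MvPolynomial (Fin (k + 1)) ℂ))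
    (hY : ∀ i j, Y i j ≠ 0 → (Y i j).totalDegree + lev i ≤ lev j) (d : ℕ) :
    ∀ i j, (Y ^ d) i j ≠ 0 → ((Y ^ d) i j).totalDegree + lev i ≤ lev j := by
  induction d with
  | zero =>
      intro i j hij
      rw [pow_zero] at hij ⊢
      by_cases h : i = j
      · subst h; rw [Matrix.one_apply_eq, totalDegree_one, zero_add]
      · exact absurd (Matrix.one_apply_ne h) hij
  | succ d ih =>
      rw [pow_succ]
      exact levGraded_mul lev _ _ ih hY

/-- Level grading of the pulled-back pencil: `N` affine and block-upper for `lev`, directions killing the same-level linear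
coefficients ⇒ entry `(i, j)` of the pull-back has `s`-degree `≤ lev j − lev i`. [folklore] -/
theorem levGraded_aeval_line {n : ℕ} (lev : Fin m → ℕ) (N : AffMat n m) (hN : IsAffine N) (hup : IsBlockUpper N lev)
    (x : Fin n × Fin n → ℂ) (v : Fin (k + 1) → (Fin n × Fin n → ℂ))
    (hv : ∀ t (i j : Fin m), lev i = lev j → ∑ c, v t c * coeff (Finsupp.single c 1) (N i j) = 0) :
    ∀ i j, (N.map (aeval (fun c => (C (x c) + ∑ t, C (v t c) * X t : MvPolynomial (Fin (k + 1)) ℂ))))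
        i j ≠ 0 →
      ((N.map (aeval (fun c => (C (x c) + ∑ t, C (v t c) * X t : MvPolynomial (Fin (k + 1)) ℂ))))
        i j).totalDegree + lev i ≤ lev j := by
  intro i j hij
  rw [Matrix.map_apply] at hij ⊢
  have hle : lev i ≤ lev j := by
    by_contra h
    exact hij (by rw [hup i j (not_le.mp h), map_zero])
  by_cases heq : lev i = lev j
  · rw [aeval_line_of_totalDegree_le_one x v (hN i j)]
    simp only [hv _ i j heq, map_zero, zero_mul, Finset.sum_const_zero, add_zero, totalDegree_C,
      zero_add]
    exact hle
  · have h1 := totalDegree_aeval_line_le_one x v (hN i j)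
    omega

/-- Degree of the pulled-back trace product for a `g`-level block form: `≤ g`. [folklore] -/
theorem totalDegree_aeval_line_trace_le_lev {n d g : ℕ} (lev : Fin m → ℕ) (N M : AffMat n m)
    (hN : IsAffine N) (hM : IsAffine M) (hup : IsBlockUpper N lev) (hg : ∀ u : Fin m, lev u < g)
    (x : Fin n × Fin n → ℂ) (v : Fin (g + 1) → (Fin n × Fin n → ℂ))
    (hv : ∀ t (i j : Fin m), lev i = lev j → ∑ c, v t c * coeff (Finsupp.single c 1) (N i j) = 0) :
    (aeval (fun c => (C (x c) + ∑ t, C (v t c) * X t : MvPolynomial (Fin (g + 1)) ℂ))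
      ((N ^ d * M).trace)).totalDegree ≤ g := by
  set θ : Fin n × Fin n → MvPolynomial (Fin (g + 1)) ℂ := fun c => C (x c) + ∑ t, C (v t c) * X t
    with hθ
  have hmap : aeval θ ((N ^ d * M).trace) = ((N.map (aeval θ)) ^ d * M.map (aeval θ)).trace := by
    rw [show N.map (aeval θ) = (aeval θ).toRingHom.mapMatrix N from rfl,
      show M.map (aeval θ) = (aeval θ).toRingHom.mapMatrix M from rfl, ← map_pow, ← map_mul]
    simp only [Matrix.trace, Matrix.diag_apply, map_sum, RingHom.mapMatrix_apply, Matrix.map_apply]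
    rfl
  rw [hmap, Matrix.trace]
  simp only [Matrix.diag_apply, Matrix.mul_apply]
  have hgr := levGraded_pow lev (N.map (aeval θ)) (levGraded_aeval_line lev N hN hup x v hv) d
  have hbound : ∀ i j : Fin m, ((N.map (aeval θ) ^ d) i j * (M.map (aeval θ)) j i).totalDegree ≤ g := by
    intro i j
    by_cases h0 : (N.map (aeval θ) ^ d) i j = 0
    · rw [h0, zero_mul, totalDegree_zero]; exact Nat.zero_le _
    · have h1 := hgr i j h0
      have h2 : ((M.map (aeval θ)) j i).totalDegree ≤ 1 := by
        rw [Matrix.map_apply]; exact totalDegree_aeval_line_le_one x v (hM j i)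
      have h3 := totalDegree_mul ((N.map (aeval θ) ^ d) i j) ((M.map (aeval θ)) j i)
      have hj : lev j + 1 ≤ g := hg j
      omega
  refine (totalDegree_finsetSum _ _).trans (Finset.sup_le fun i _ => ?_)
  exact (totalDegree_finsetSum _ _).trans (Finset.sup_le fun j _ => hbound i j)

end LevelFlatProof

/-- **F1 PROVED.** Level flatness: `dim K ≤ 2·g·n` (block grading along `K`-cosets + LEMMA_g, p593106). [folklore] -/
theorem levelFlat_proof : LevelFlat := by
  intro n m d g N M lev K hN hM hup hg hper hK
  classical
  have hflat : ∀ dv : Fin (g + 1) → (Fin n × Fin n → ℂ), (∀ t, dv t ∈ K) →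
      (List.ofFn dv).foldr
        (fun u f => mkDerivation ℂ (fun c => (C (u c) : MvPolynomial (Fin n × Fin n) ℂ)) f)
        (perPoly (Fin n) ℂ) = 0 := by
    intro dv hdv
    refine foldr_mkDerivation_eq_zero_of_totalDegree_le K _ (fun x v hv => ?_) dv hdv
    rw [hper]
    exact totalDegree_aeval_line_trace_le_lev lev N M hN hM hup hg x v
      (fun t i j hij => hK (v t) (hv t) i j hij)
  have h := finrank_le_of_iterD_perPoly_eq_zero K hflat
  calc Module.finrank ℂ K ≤ g * (2 * n) := h
    _ = 2 * g * n := by ring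

/-! ## Kernel-checked composition -/

/-- **The deciding chain of the line:** `LevelFlat → CheapParameterMass → DualUnipotentThreeHalves` (target decl BY NAME;
the hypothesis of the target is definitionally `DualUnipotentRepr n m`).  Arithmetic: `s := ⌊√n⌋`,
`n² ≤ 2gn + C·m·s`, `g·s ≤ C(m+s)` ⇒ `s·n ≤ 3Cm + 2Cs` ⇒ (`n ≥ 4C`) `s·n ≤ 6Cm` ⇒ `n³ ≤ 4s²n² ≤ 144·C²·m²`. -/
theorem dualUnipotentThreeHalves_of (hF1 : LevelFlat) (hF2 : CheapParameterMass) : DualUnipotentThreeHalves := by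
  obtain ⟨C, n₀, hC⟩ := hF2
  refine ⟨144 * C ^ 2, max n₀ (max 4 (4 * C)), ?_⟩
  intro n hn m hrep
  have hn₀ : n₀ ≤ n := le_trans (le_max_left _ _) hn
  have hn4 : 4 ≤ n := le_trans (le_trans (le_max_left _ _) (le_max_right _ _)) hn
  have hnC : 4 * C ≤ n := le_trans (le_trans (le_max_right _ _) (le_max_right _ _)) hn
  have hrep' : DualUnipotentRepr n m := hrep
  obtain ⟨N, M, lev, g, K, hN, hM, hper, hup, hg, hK, hgs, hmass⟩ := hC n hn₀ m hrep'
  have hdim : Module.finrank ℂ K ≤ 2 * g * n := hF1 n m (n - 1) g N M lev K hN hM hup hg hper hK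
  set s := Nat.sqrt n with hs
  have hs1 : s ^ 2 ≤ n := Nat.sqrt_le' n
  have hs2 : n < (s + 1) ^ 2 := Nat.lt_succ_sqrt' n
  have hs0 : 1 ≤ s := Nat.succ_le_of_lt (Nat.sqrt_pos.2 (by omega))
  have hn0 : 0 < n := by omega
  -- `n² ≤ 2gn + C m s`
  have h0 : n ^ 2 ≤ 2 * g * n + C * m * s := le_trans hmass (Nat.add_le_add_right hdim _)
  -- multiply by `s`, use `g s ≤ C(m+s)` and `s² ≤ n`
  have h1 : s * n ^ 2 ≤ n * (3 * C * m + 2 * C * s) := by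
    have e1 : s * n ^ 2 ≤ s * (2 * g * n + C * m * s) := Nat.mul_le_mul_left s h0
    have e2 : 2 * (g * s) * n ≤ 2 * (C * (m + s)) * n :=
      Nat.mul_le_mul_right n (Nat.mul_le_mul_left 2 hgs)
    have e3 : C * m * (s * s) ≤ C * m * n := Nat.mul_le_mul_left (C * m) (by nlinarith [hs1])
    nlinarith [e1, e2, e3]
  have h2 : s * n ≤ 3 * C * m + 2 * C * s := by
    have h1' : n * (s * n) ≤ n * (3 * C * m + 2 * C * s) := by nlinarith [h1]
    exact Nat.le_of_mul_le_mul_left h1' hn0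
  -- `n ≥ 4C`: `2Cs·2 ≤ s n`, so `s n ≤ 6 C m`
  have h3 : s * n ≤ 6 * C * m := by nlinarith [h2, hnC, Nat.mul_le_mul_left s hnC]
  have h4 : (s * n) * (s * n) ≤ (6 * C * m) * (6 * C * m) := Nat.mul_le_mul h3 h3
  have hs3 : n ≤ 4 * s ^ 2 := by nlinarith [hs2, hs0]
  have h5 : n * n ^ 2 ≤ (4 * s ^ 2) * n ^ 2 := Nat.mul_le_mul_right (n ^ 2) hs3
  nlinarith [h4, h5]

/-- The target through F1 (PROVED) and the one open stub `stub_cheapParameterMass` (the crux). -/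
theorem dualUnipotentThreeHalves_via_stubs : DualUnipotentThreeHalves :=
  dualUnipotentThreeHalves_of levelFlat_proof stub_cheapParameterMass

/-! ## Sanity: the profile-barrier / triangularisable shape satisfies F2's block conditions -/

/-- For a STRICTLY upper triangular `N`, the identity level function is a block form, and the whole direction space is
«diagonal-still» (the constituents are zero): F2 then asks only `m ≤ C(m + √n)·…`-type arithmetic — with `lev = id` it records only
the block shape; F2's witness for a triangularisable pencil uses `⌈√n⌉`-blocks of the flag (mass `≤ m√n/2`). [folklore] -/
theorem diagStill_top_of_strictUpper {n m : ℕ} (N : AffMat n m) (htri : ∀ i j : Fin m, j ≤ i → N i j = 0) :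
    IsBlockUpper N (fun u => u.val) ∧ DiagStill N (fun u => u.val) ⊤ := by
  refine ⟨fun i j hij => htri i j (le_of_lt (Fin.lt_def.2 hij)), ?_⟩
  intro v _ i j hij
  have hz : N i j = 0 := htri i j (le_of_eq (Fin.ext hij.symm))
  simp [linCoeff, hz]

end Summit.ValiantsHypothesis.ValiantsHypothesis.Cruxes.DualUnipotentThreeHalves.WildMass

end
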